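import Mathlib

/-!
# Counting lemmas for the squarefree sieve behind `OmegaToMobiusAP` (stmt-Parity-11588)

Elementary, self-contained inputs for the junction `QuadraticOmegaParity → μ(f(n)) = o(x)` along
arithmetic progressions (route `IsogenyRedei`, item `OmegaToMobiusAP`):

* `card_primesLE_le` / `isLittleO_card_primesLE`: a Chebyshev-lite bound `π(N) ≤ N/k + 4^k + 1`
  from `primorial N ≤ 4^N`, hence `π(N) = o(N)`;
* `card_filter_Icc_modEq_le`: a residue class mod `m` meets `[1, x]` in `≤ x/m + 1` points;
* `sq_dvd_sub_or_add`, `three_roots`, `card_roots_Icc_le`: for a prime `p ∤ 2A(B² − 4AC)` the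
  roots of `A n² + B n + C` modulo `p²` lie in at most two classes, so `[1, x]` contains at most
  `2 (x/p² + 1)` of them;
* `sum_filter_modEq_regroup`: regrouping a sum over `n ≡ a (q)` with a condition on `n mod M`
  (`q ∣ M`) into full progressions mod `M`;
* `isLittleO_of_forall_approx`: the `R → ∞` bookkeeping.

No analytic input beyond `primorial_le_four_pow`.
-/

open Filter Finset Asymptotics

namespace Summit.Parity.BatemanHorn.Theorems.OmegaToMobiusAP

/-! ### Chebyshev-lite -/

/-- `π(N) ≤ N / k + 4 ^ k + 1` for every `k ≥ 1`: the primes in `(4^k, N]` have product at least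
`(4^k)^{#}` and at most `primorial N ≤ 4^N`. [folklore] -/
theorem card_primesLE_le (N k : ℕ) (hk : 0 < k) :
    (Nat.primesLE N).card ≤ N / k + (4 ^ k + 1) := by
  classical
  set P := Nat.primesLE N with hP
  set P₁ := P.filter (fun p => 4 ^ k < p) with hP₁
  set P₂ := P.filter (fun p => ¬ 4 ^ k < p) with hP₂
  have hsplit : P₁.card + P₂.card = P.card := Finset.card_filter_add_card_filter_not _
  have h2 : P₂.card ≤ 4 ^ k + 1 := by
    calc P₂.card ≤ (Finset.range (4 ^ k + 1)).card := by
          refine Finset.card_le_card (fun p hp => ?_)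
          simp only [hP₂, Finset.mem_filter, not_lt] at hp
          simp only [Finset.mem_range]
          omega
      _ = 4 ^ k + 1 := Finset.card_range _
  have h1 : k * P₁.card ≤ N := by
    have hprod : (4 ^ k) ^ P₁.card ≤ 4 ^ N := by
      calc (4 ^ k) ^ P₁.card ≤ ∏ p ∈ P₁, p :=
            Finset.pow_card_le_prod P₁ (fun p => p) (4 ^ k)
              (fun p hp => (Finset.mem_filter.mp hp).2.le)
        _ ≤ ∏ p ∈ P, p :=
            Finset.prod_le_prod_of_subset_of_one_le' (Finset.filter_subset _ _)
              (fun p hp _ => (Nat.prime_of_mem_primesLE hp).one_le)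
        _ = primorial N := (primorial_eq_prod_primesLE N).symm
        _ ≤ 4 ^ N := primorial_le_four_pow N
    rw [← pow_mul] at hprod
    exact (Nat.pow_le_pow_iff_right (by norm_num)).mp hprod
  have h1' : P₁.card ≤ N / k := by
    rw [Nat.le_div_iff_mul_le hk, mul_comm]
    exact h1
  omega

/-- The primes have density zero: `π(N) = o(N)`. [folklore] -/
theorem isLittleO_card_primesLE :
    (fun N : ℕ => ((Nat.primesLE N).card : ℝ)) =o[atTop] (fun N : ℕ => (N : ℝ)) := by
  refine Asymptotics.isLittleO_iff.mpr (fun c hc => ?_)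
  obtain ⟨k, hk⟩ := exists_nat_gt (2 / c)
  have hkpos : 0 < k := by
    rcases Nat.eq_zero_or_pos k with h | h
    · subst h
      have : (0 : ℝ) < 2 / c := div_pos two_pos hc
      simp at hk
      linarith
    · exact h
  filter_upwards [eventually_ge_atTop (⌈(2 * (4 ^ k + 1) / c : ℝ)⌉₊)] with N hN
  have hb := card_primesLE_le N k hkpos
  have hN' : (2 * (4 ^ k + 1) / c : ℝ) ≤ N := (Nat.le_ceil _).trans (by exact_mod_cast hN)
  rw [Real.norm_natCast, Real.norm_natCast]
  have h1 : ((N / k : ℕ) : ℝ) ≤ (N : ℝ) / k := Nat.cast_div_le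
  have hk' : (0 : ℝ) < k := by exact_mod_cast hkpos
  have h2 : (N : ℝ) / k ≤ c / 2 * N := by
    rw [div_le_iff₀ hk']
    have h3 : 1 ≤ c / 2 * k := by
      have := (div_lt_iff₀ hc).mp hk
      linarith
    nlinarith [Nat.cast_nonneg (α := ℝ) N]
  have h3 : ((4 : ℝ) ^ k + 1) ≤ c / 2 * N := by
    rw [div_le_iff₀ hc] at hN'
    linarith
  calc ((Nat.primesLE N).card : ℝ) ≤ ((N / k + (4 ^ k + 1) : ℕ) : ℝ) := by exact_mod_cast hb
    _ = ((N / k : ℕ) : ℝ) + ((4 : ℝ) ^ k + 1) := by push_cast; ring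
    _ ≤ c / 2 * N + c / 2 * N := add_le_add (h1.trans h2) h3
    _ = c * N := by ring

/-! ### Points of a residue class in an interval -/

/-- A residue class modulo `m` meets `[1, x]` in at most `x / m + 1` integers (for `m = 0` the
class is a single integer and `x / 0 + 1 = 1`). [folklore] -/
theorem card_filter_Icc_modEq_le (x m : ℕ) (c : ℤ) :
    ((Finset.Icc 1 x).filter (fun n : ℕ => (n : ℤ) ≡ c [ZMOD m])).card ≤ x / m + 1 := by
  classical
  set S := (Finset.Icc 1 x).filter (fun n : ℕ => (n : ℤ) ≡ c [ZMOD m]) with hS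
  have hinj : Set.InjOn (fun n : ℕ => n / m) S := by
    intro n hn n' hn' h
    simp only [hS, Finset.coe_filter, Set.mem_setOf_eq] at hn hn'
    have hmod : (n : ℤ) ≡ n' [ZMOD m] := hn.2.trans hn'.2.symm
    have hmod' : n ≡ n' [MOD m] := Int.natCast_modEq_iff.mp hmod
    unfold Nat.ModEq at hmod'
    simp only at h
    calc n = m * (n / m) + n % m := (Nat.div_add_mod n m).symm
      _ = m * (n' / m) + n' % m := by rw [h, hmod']
      _ = n' := Nat.div_add_mod n' m
  have hmaps : Set.MapsTo (fun n : ℕ => n / m) S (Finset.range (x / m + 1)) := by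
    intro n hn
    simp only [hS, Finset.coe_filter, Set.mem_setOf_eq, Finset.mem_Icc] at hn
    simp only [Finset.coe_range, Set.mem_Iio]
    exact Nat.lt_succ_of_le (Nat.div_le_div_right hn.1.2)
  calc S.card ≤ (Finset.range (x / m + 1)).card := Finset.card_le_card_of_injOn _ hmaps hinj
    _ = x / m + 1 := Finset.card_range _

/-! ### Roots of a quadratic modulo `p²` -/

/-- For a prime `p` with `p ∤ 2u`, `p² ∣ u² − v²` forces `p² ∣ u − v` or `p² ∣ u + v`.
[folklore] -/
theorem sq_dvd_sub_or_add {p : ℕ} (hp : p.Prime) {u v : ℤ} (hu : ¬ (p : ℤ) ∣ 2 * u)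
    (h : (p : ℤ) ^ 2 ∣ u ^ 2 - v ^ 2) :
    (p : ℤ) ^ 2 ∣ u - v ∨ (p : ℤ) ^ 2 ∣ u + v := by
  have hp' : Prime (p : ℤ) := Nat.prime_iff_prime_int.mp hp
  have hfac : u ^ 2 - v ^ 2 = (u - v) * (u + v) := by ring
  rw [hfac] at h
  by_cases h1 : (p : ℤ) ∣ u - v
  · have h2 : ¬ (p : ℤ) ∣ u + v := by
      intro h2
      apply hu
      have h3 : (p : ℤ) ∣ (u - v) + (u + v) := dvd_add h1 h2
      have e : (u - v) + (u + v) = 2 * u := by ring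
      rwa [e] at h3
    left
    have hcop : IsCoprime ((p : ℤ) ^ 2) (u + v) :=
      (hp'.irreducible.coprime_iff_not_dvd.mpr h2).pow_left
    exact hcop.dvd_of_dvd_mul_right h
  · right
    have hcop : IsCoprime ((p : ℤ) ^ 2) (u - v) :=
      (hp'.irreducible.coprime_iff_not_dvd.mpr h1).pow_left
    exact hcop.dvd_of_dvd_mul_left h

/-- Among three roots of `A n² + B n + C` modulo `p²`, for a prime `p ∤ 2A(B² − 4AC)`, two are
congruent modulo `p²` (complete the square: `4A·f(n) = (2An + B)² − D`). [folklore] -/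
theorem three_roots {p : ℕ} (hp : p.Prime) {A B C : ℤ}
    (hpd : ¬ (p : ℤ) ∣ 2 * A * (B ^ 2 - 4 * A * C)) {n₁ n₂ n₃ : ℤ}
    (h₁ : (p : ℤ) ^ 2 ∣ A * n₁ ^ 2 + B * n₁ + C) (h₂ : (p : ℤ) ^ 2 ∣ A * n₂ ^ 2 + B * n₂ + C)
    (h₃ : (p : ℤ) ^ 2 ∣ A * n₃ ^ 2 + B * n₃ + C) :
    (p : ℤ) ^ 2 ∣ n₁ - n₂ ∨ (p : ℤ) ^ 2 ∣ n₁ - n₃ ∨ (p : ℤ) ^ 2 ∣ n₂ - n₃ := by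
  have hp' : Prime (p : ℤ) := Nat.prime_iff_prime_int.mp hp
  set D := B ^ 2 - 4 * A * C with hD
  have h2A : ¬ (p : ℤ) ∣ 2 * A := fun h => hpd (dvd_mul_of_dvd_left h _)
  have hDp : ¬ (p : ℤ) ∣ D := fun h => hpd (dvd_mul_of_dvd_right h _)
  have hp2 : ¬ (p : ℤ) ∣ 2 := fun h => h2A (dvd_mul_of_dvd_left h _)
  have hcop : IsCoprime ((p : ℤ) ^ 2) (2 * A) :=
    (hp'.irreducible.coprime_iff_not_dvd.mpr h2A).pow_left
  have key : ∀ n : ℤ, (p : ℤ) ^ 2 ∣ A * n ^ 2 + B * n + C →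
      (p : ℤ) ^ 2 ∣ (2 * A * n + B) ^ 2 - D ∧ ¬ (p : ℤ) ∣ 2 * (2 * A * n + B) := by
    intro n hn
    have e : (2 * A * n + B) ^ 2 - D = 4 * A * (A * n ^ 2 + B * n + C) := by
      simp only [hD]; ring
    have hsq : (p : ℤ) ^ 2 ∣ (2 * A * n + B) ^ 2 - D := e ▸ dvd_mul_of_dvd_right hn _
    refine ⟨hsq, fun h => ?_⟩
    rcases hp'.dvd_or_dvd h with h2 | hu
    · exact hp2 h2
    · apply hDp
      have hpf : (p : ℤ) ∣ (2 * A * n + B) ^ 2 - D := (dvd_pow_self (p : ℤ) two_ne_zero).trans hsq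
      have e2 : D = (2 * A * n + B) ^ 2 - ((2 * A * n + B) ^ 2 - D) := by ring
      rw [e2]
      exact dvd_sub (dvd_pow hu two_ne_zero) hpf
  obtain ⟨k₁, hu₁⟩ := key n₁ h₁
  obtain ⟨k₂, -⟩ := key n₂ h₂
  obtain ⟨k₃, -⟩ := key n₃ h₃
  have d12 : (p : ℤ) ^ 2 ∣ (2 * A * n₁ + B) ^ 2 - (2 * A * n₂ + B) ^ 2 := by
    have := dvd_sub k₁ k₂
    have e : (2 * A * n₁ + B) ^ 2 - D - ((2 * A * n₂ + B) ^ 2 - D)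
        = (2 * A * n₁ + B) ^ 2 - (2 * A * n₂ + B) ^ 2 := by ring
    rwa [e] at this
  have d13 : (p : ℤ) ^ 2 ∣ (2 * A * n₁ + B) ^ 2 - (2 * A * n₃ + B) ^ 2 := by
    have := dvd_sub k₁ k₃
    have e : (2 * A * n₁ + B) ^ 2 - D - ((2 * A * n₃ + B) ^ 2 - D)
        = (2 * A * n₁ + B) ^ 2 - (2 * A * n₃ + B) ^ 2 := by ring
    rwa [e] at this
  rcases sq_dvd_sub_or_add hp hu₁ d12 with h | h
  · left
    have e : 2 * A * n₁ + B - (2 * A * n₂ + B) = 2 * A * (n₁ - n₂) := by ring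
    rw [e] at h
    exact hcop.dvd_of_dvd_mul_left h
  · rcases sq_dvd_sub_or_add hp hu₁ d13 with h' | h'
    · right; left
      have e : 2 * A * n₁ + B - (2 * A * n₃ + B) = 2 * A * (n₁ - n₃) := by ring
      rw [e] at h'
      exact hcop.dvd_of_dvd_mul_left h'
    · right; right
      have h'' := dvd_sub h h'
      have e : 2 * A * n₁ + B + (2 * A * n₂ + B) - (2 * A * n₁ + B + (2 * A * n₃ + B))
          = 2 * A * (n₂ - n₃) := by ring
      rw [e] at h''
      exact hcop.dvd_of_dvd_mul_left h''

/-- The roots of `A n² + B n + C` modulo `p²` (`p` prime, `p ∤ 2A(B² − 4AC)`) lie in at most two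
residue classes modulo `p²`. [folklore] -/
theorem roots_subset_two_classes {p : ℕ} (hp : p.Prime) {A B C : ℤ}
    (hpd : ¬ (p : ℤ) ∣ 2 * A * (B ^ 2 - 4 * A * C)) :
    ∃ c₁ c₂ : ℤ, ∀ n : ℤ, (p : ℤ) ^ 2 ∣ A * n ^ 2 + B * n + C →
      n ≡ c₁ [ZMOD ((p ^ 2 : ℕ) : ℤ)] ∨ n ≡ c₂ [ZMOD ((p ^ 2 : ℕ) : ℤ)] := by
  classical
  have cast2 : (((p ^ 2 : ℕ) : ℤ)) = (p : ℤ) ^ 2 := by push_cast; ring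
  by_cases hex : ∃ n₁ : ℤ, (p : ℤ) ^ 2 ∣ A * n₁ ^ 2 + B * n₁ + C
  · obtain ⟨n₁, hn₁⟩ := hex
    by_cases hex2 : ∃ n₂ : ℤ, (p : ℤ) ^ 2 ∣ A * n₂ ^ 2 + B * n₂ + C ∧ ¬ (p : ℤ) ^ 2 ∣ n₁ - n₂
    · obtain ⟨n₂, hn₂, hne⟩ := hex2
      refine ⟨n₁, n₂, fun n hn => ?_⟩
      rcases three_roots hp hpd hn₁ hn₂ hn with h | h | h
      · exact absurd h hne
      · left
        rw [Int.modEq_iff_dvd, cast2]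
        exact h
      · right
        rw [Int.modEq_iff_dvd, cast2]
        exact h
    · push Not at hex2
      refine ⟨n₁, n₁, fun n hn => Or.inl ?_⟩
      rw [Int.modEq_iff_dvd, cast2]
      exact hex2 n hn
  · push Not at hex
    exact ⟨0, 0, fun n hn => absurd hn (hex n)⟩

/-- **Local count.** For a prime `p ∤ 2A(B² − 4AC)`, at most `2 (x / p² + 1)` integers
`n ∈ [1, x]` have `p² ∣ A n² + B n + C`. [folklore] -/
theorem card_roots_Icc_le {p : ℕ} (hp : p.Prime) {A B C : ℤ}
    (hpd : ¬ (p : ℤ) ∣ 2 * A * (B ^ 2 - 4 * A * C)) (x : ℕ) :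
    ((Finset.Icc 1 x).filter (fun n : ℕ => (p : ℤ) ^ 2 ∣ A * n ^ 2 + B * n + C)).card ≤
      2 * (x / p ^ 2 + 1) := by
  classical
  obtain ⟨c₁, c₂, hc⟩ := roots_subset_two_classes hp hpd
  set S₁ := (Finset.Icc 1 x).filter (fun n : ℕ => (n : ℤ) ≡ c₁ [ZMOD ((p ^ 2 : ℕ) : ℤ)])
  set S₂ := (Finset.Icc 1 x).filter (fun n : ℕ => (n : ℤ) ≡ c₂ [ZMOD ((p ^ 2 : ℕ) : ℤ)])
  calc ((Finset.Icc 1 x).filter (fun n : ℕ => (p : ℤ) ^ 2 ∣ A * n ^ 2 + B * n + C)).card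
        ≤ (S₁ ∪ S₂).card := by
          refine Finset.card_le_card (fun n hn => ?_)
          rw [Finset.mem_filter] at hn
          rw [Finset.mem_union, Finset.mem_filter, Finset.mem_filter]
          rcases hc n hn.2 with h | h
          · exact Or.inl ⟨hn.1, h⟩
          · exact Or.inr ⟨hn.1, h⟩
    _ ≤ S₁.card + S₂.card := Finset.card_union_le _ _
    _ ≤ (x / p ^ 2 + 1) + (x / p ^ 2 + 1) :=
          add_le_add (card_filter_Icc_modEq_le x _ c₁) (card_filter_Icc_modEq_le x _ c₂)
    _ = 2 * (x / p ^ 2 + 1) := by ring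

/-! ### Regrouping a progression by residues modulo a multiple of the modulus -/

/-- Splitting `{n ∈ [1, x] : n ≡ a (q), P (n mod M)}` (`q ∣ M`, `0 < M`) into the full
progressions `n ≡ c (M)` over the residues `c < M` with `c ≡ a (q)` and `P c`. [folklore] -/
theorem sum_filter_modEq_regroup (F : ℕ → ℝ) (P : ℕ → Prop) [DecidablePred P] {q M : ℕ}
    (hM : 0 < M) (hqM : q ∣ M) (a x : ℕ) :
    ∑ n ∈ (Finset.Icc 1 x).filter (fun n : ℕ => n ≡ a [MOD q] ∧ P (n % M)), F n
      = ∑ c ∈ (Finset.range M).filter (fun c : ℕ => c ≡ a [MOD q] ∧ P c),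
          ∑ n ∈ (Finset.Icc 1 x).filter (fun n : ℕ => n ≡ c [MOD M]), F n := by
  classical
  set s := (Finset.Icc 1 x).filter (fun n : ℕ => n ≡ a [MOD q] ∧ P (n % M)) with hs
  set t := (Finset.range M).filter (fun c : ℕ => c ≡ a [MOD q] ∧ P c) with ht
  have hmaps : ∀ n ∈ s, n % M ∈ t := by
    intro n hn
    simp only [hs, Finset.mem_filter, Finset.mem_Icc] at hn
    simp only [ht, Finset.mem_filter, Finset.mem_range]
    exact ⟨Nat.mod_lt n hM, ((Nat.mod_modEq n M).of_dvd hqM).trans hn.2.1, hn.2.2⟩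
  rw [← Finset.sum_fiberwise_of_maps_to hmaps F]
  refine Finset.sum_congr rfl (fun c hc => ?_)
  simp only [ht, Finset.mem_filter, Finset.mem_range] at hc
  have hcM : c % M = c := Nat.mod_eq_of_lt hc.1
  apply Finset.sum_congr _ (fun _ _ => rfl)
  ext n
  simp only [hs, Finset.mem_filter, Finset.mem_Icc, Nat.ModEq]
  constructor
  · rintro ⟨⟨hn, -, -⟩, hnc⟩
    exact ⟨hn, by rw [hnc, hcM]⟩
  · rintro ⟨hn, hnc⟩
    rw [hcM] at hnc
    refine ⟨⟨hn, ?_, by rw [hnc]; exact hc.2.2⟩, hnc⟩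
    have h1 : n ≡ c [MOD q] := (show n ≡ c [MOD M] by unfold Nat.ModEq; rw [hnc, hcM]).of_dvd hqM
    exact h1.trans hc.2.1

/-! ### The `R → ∞` bookkeeping -/

/-- If for every `R ≥ R₀` one has `|S x| ≤ |G_R x| + 2x/R` with `G_R = o(x)`, then `S = o(x)`.
[folklore] -/
theorem isLittleO_of_forall_approx {S : ℕ → ℝ} (R₀ : ℕ) (G : ℕ → ℕ → ℝ)
    (hG : ∀ R, R₀ ≤ R → (G R) =o[atTop] (fun x : ℕ => (x : ℝ)))
    (hS : ∀ R, R₀ ≤ R → 0 < R → ∀ x : ℕ, |S x| ≤ |G R x| + 2 * x / R) :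
    S =o[atTop] (fun x : ℕ => (x : ℝ)) := by
  refine Asymptotics.isLittleO_iff.mpr (fun c hc => ?_)
  set R := max R₀ (⌈4 / c⌉₊ + 1) with hR
  have hR₀ : R₀ ≤ R := le_max_left _ _
  have hRpos : 0 < R := lt_of_lt_of_le (Nat.succ_pos _) (le_max_right _ _)
  have hRc : (4 / c : ℝ) ≤ R := by
    have h1 : (4 / c : ℝ) ≤ (⌈4 / c⌉₊ : ℝ) := Nat.le_ceil _
    have h2 : ((⌈4 / c⌉₊ : ℕ) : ℝ) ≤ R := by
      exact_mod_cast (Nat.le_succ _).trans (le_max_right R₀ _)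
    exact h1.trans h2
  have hev := Asymptotics.isLittleO_iff.mp (hG R hR₀) (half_pos hc)
  filter_upwards [hev] with x hx
  rw [Real.norm_natCast, Real.norm_eq_abs] at hx ⊢
  have hRr : (0 : ℝ) < R := by exact_mod_cast hRpos
  have h2 : 2 * (x : ℝ) / R ≤ c / 2 * x := by
    rw [div_le_iff₀ hRr]
    have h4 : (4 : ℝ) ≤ c * R := by
      rw [div_le_iff₀ hc] at hRc
      linarith
    nlinarith [Nat.cast_nonneg (α := ℝ) x]
  calc |S x| ≤ |G R x| + 2 * x / R := hS R hR₀ hRpos x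
    _ ≤ c / 2 * x + c / 2 * x := add_le_add hx h2
    _ = c * x := by ring

end Summit.Parity.BatemanHorn.Theorems.OmegaToMobiusAP
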